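import Summits.AtomisticToContinuum.HydrodynamicLimit.Theses.JParityClosure
import Summits.AtomisticToContinuum.HydrodynamicLimit.Theorems.LambertianContactSwapSwapGapGibbsDomination
import Literature.Probability.Divergences.EntropyEventBound
import HarnessLib

/-!
# Crux `JParityClosure.RateFloor` (stmt-AtomisticToContinuum-13080), line `Sketch`: THE ENTROPY TRANSFER

Support file (`--supports stmt-AtomisticToContinuum-13080`; registered stubs `stub_rateFloor_of_eqSuperExpDeficit`,
`stub_rateFloor_of_entropyClass`) for the registered skeleton `Cruxes/RateFloor/Lines/Sketch.lean` §7½ (continuation lead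
c4).  The def-free tree copy of the line's NEW FIRST COMPOSITION: the crux `RateFloor` — a one-sided floor
`K_N[χΞ] ≥ g₀σ³∫₀^τ∫χB^Ξ_r − η` in probability along the hard-sphere flow from EVERY continuous local Gibbs datum — follows from
ONE statement about GLOBAL EQUILIBRIUM dynamics, the super-exponential deficit bound (registered stub S11
`stub_eqSuperExpDeficit` of the line, here the HYPOTHESIS, written out verbatim): under the standard homogeneous canonical Gibbs
law `G_N = localGibbsLaw σ 1 0 1 N (Φ N)` (invariant under every hard-sphere flow) the crux's deficit event has probability
`≤ exp(−L(N+1))` for every `L` once `r < r₀(L)`, `N ≥ N₀`.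

Mechanism (Yau's relative-entropy method reduced to its two elementary levers, both tree theorems):
* the entropy budget of local Gibbs data is LINEAR — `KL(localGibbsLaw σ a₀ u₀ θ₀ ‖ G_N) ≤ A(profiles, σ)·(N+1)`
  (`LambertianContactSwapSwapGapGibbsDomination.exists_localGibbsLaw_dominated`, Kipnis–Landim Ch. 6 §1);
* the entropy inequality for events — `P(E) ≤ e^{-G}`, `KL(Q ‖ P) ≤ H` ⇒ `Q(E) ≤ (log 2 + H)/G`
  (`Literature.Probability.Divergences.toReal_measure_le_of_klDiv_le`, Kipnis–Landim App. 1 Prop. 8.2), applied to a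
  measurable hull of the event so that no measurability of the collision functional is needed (`measure_le_of_klDiv_le_hull`);
* bookkeeping: the crux files `∀ η δ ∃ r₀`, so `r₀ := r₀(L)` with `L := (log 2 + A + 1)/δ` is admissible — this quantifier
  order is the whole point (at a single time the static deficit costs only `e^{-cN}` with `c` independent of `r`, BN1; the
  TIME-INTEGRATED deficit needs persistent sub-`r` segregation, cold or fast, whose equilibrium cost per particle diverges as
  `r → 0`).
Intermediate notion, also def-free: the crux for the ENTROPY CLASS of initial laws (every probability law `μ_N` with
`KL(μ_N ‖ G_N) ≤ K(N+1)`), `rateFloor_of_entropyClass` + `entropyClass_of_eqSuperExpDeficit`.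
References: C. Kipnis, C. Landim, *Scaling Limits of Interacting Particle Systems* (1999), App. 1 §8, Ch. 6 §1; H.-T. Yau,
Lett. Math. Phys. 22 (1991) §2.  prover-line-stmt-AtomisticToContinuum-13080-c4-0.
-/

noncomputable section

open scoped BigOperators Topology ENNReal NNReal InnerProductSpace RealInnerProductSpace Classical
open MeasureTheory Set Filter Function InformationTheory
open Literature.Analysis.FluidPDE Literature.MathematicalPhysics.KineticTheory
open Summit.AtomisticToContinuum.HydrodynamicLimit.Theses.JParityClosure

namespace Summit.AtomisticToContinuum.HydrodynamicLimit.Theorems.RateFloorEntropyTransfer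

/-! ## The two elementary levers -/

/-- Arithmetic of the entropy transfer: with `L = (log 2 + K + 1)/δ` and `n ≥ 1`, `(log 2 + K n)/(L n) ≤ δ`. [folklore] -/
theorem entropy_transfer_arith {K δ n : ℝ} (hK : 0 ≤ K) (hδ : 0 < δ) (hn : 1 ≤ n) :
    (Real.log 2 + K * n) / ((Real.log 2 + K + 1) / δ * n) ≤ δ := by
  have hlog : 0 < Real.log 2 := Real.log_pos (by norm_num)
  have hL : 0 < (Real.log 2 + K + 1) / δ := by positivity
  rw [div_le_iff₀ (by positivity)]
  have h1 : δ * ((Real.log 2 + K + 1) / δ * n) = (Real.log 2 + K + 1) * n := by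
    field_simp
  rw [h1]
  nlinarith

/-- **Entropy inequality for events, through a measurable hull** (no measurability of the event is needed): if
`P(E) ≤ e^{-G}` for the reference probability law `P` and `KL(Q ‖ P) ≤ H`, then `Q(E) ≤ (log 2 + H)/G` — the tree's
`toReal_measure_le_of_klDiv_le` applied to `toMeasurable P E ⊇ E`, which has the same `P`-measure.
[cite: KipnisLandim1999, Appendix 1 Prop. 8.2] -/
theorem measure_le_of_klDiv_le_hull {α : Type*} [MeasurableSpace α] (Q P : Measure α)
    [IsProbabilityMeasure Q] [IsProbabilityMeasure P] (E : Set α) {G H : ℝ}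
    (hG : 0 < G) (hH : 0 ≤ H) (hP : P E ≤ ENNReal.ofReal (Real.exp (-G)))
    (hKL : klDiv Q P ≤ ENNReal.ofReal H) :
    Q E ≤ ENNReal.ofReal ((Real.log 2 + H) / G) := by
  set E' := toMeasurable P E with hE'
  have hPE' : P E' ≤ ENNReal.ofReal (Real.exp (-G)) := by
    rw [hE', measure_toMeasurable]; exact hP
  have h := Literature.Probability.Divergences.toReal_measure_le_of_klDiv_le Q P
    (measurableSet_toMeasurable P E) hG hH hPE' hKL
  calc Q E ≤ Q E' := measure_mono (subset_toMeasurable P E)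
    _ = ENNReal.ofReal (Q E').toReal := (ENNReal.ofReal_toReal (measure_ne_top Q E')).symm
    _ ≤ ENNReal.ofReal ((Real.log 2 + H) / G) := ENNReal.ofReal_le_ofReal h

/-! ## The crux for the entropy class of initial laws -/

/-- **`RateFloor` for every initial law of linear relative entropy** (registered stub `stub_rateFloor_of_entropyClass` of line
`Sketch`; the hypothesis is the line's `EntropyClassRateFloor` written out): if the crux's event is rare under EVERY probability
law `μ_N` with `KL(μ_N ‖ G_N) ≤ K(N+1)` (with `r₀ = r₀(K, …)`), then it is rare under every continuous local Gibbs datum —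
whose entropy budget is `KL ≤ A(profiles, σ)(N+1)` (`exists_localGibbsLaw_dominated`); `σ₀ := min σ₀ ½`.
[cite: KipnisLandim1999, Ch. 6 §1] -/
theorem stub_rateFloor_of_entropyClass :
    (∃ g₀ : ℝ, 0 < g₀ ∧ ∃ σ₀ : ℝ, 0 < σ₀ ∧ ∀ σ : ℝ, 0 < σ → σ < σ₀ → ∀ Φ : (N : ℕ) → Literature.Analysis.FluidPDE.HardSphereFlow (Literature.Analysis.FluidPDE.Torus.geometry (Fin 3)) (Literature.MathematicalPhysics.KineticTheory.hsDiameter σ N) (N + 1), ∀ τ : ℝ, 0 < τ → ∀ χ : ℝ × UnitAddTorus (Fin 3) → ℝ, Continuous χ → (∀ p, 0 ≤ χ p) → ∀ Ξ : EuclideanSpace ℝ (Fin 3) × EuclideanSpace ℝ (Fin 3) × EuclideanSpace ℝ (Fin 3) → ℝ, Continuous Ξ → (∀ q, 0 ≤ Ξ q) → (∃ C : ℝ, ∀ q, Ξ q ≤ C) → ∀ K η δ : ℝ, 0 < η → 0 < δ → ∃ r₀ : ℝ, 0 < r₀ ∧ ∀ r : ℝ, 0 < r → r < r₀ → ∃ N₀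 : ℕ, ∀ N : ℕ, N₀ ≤ N → ∀ μ : MeasureTheory.Measure (Literature.Analysis.FluidPDE.Config (N + 1) (Fin 3) Literature.MathematicalPhysics.KineticTheory.T3), MeasureTheory.IsProbabilityMeasure μ → InformationTheory.klDiv μ (Literature.MathematicalPhysics.KineticTheory.localGibbsLaw σ (fun _ => (1 : ℝ)) (fun _ => (0 : EuclideanSpace ℝ (Fin 3))) (fun _ => (1 : ℝ)) N (Φ N)) ≤ ENNReal.ofReal (K * ((N : ℝ) + 1)) → let ε := Literature.MathematicalPhysics.KineticTheory.hsDiameter σ N; let G := Literature.Analysis.FluidPDE.Torus.geometry (Fin 3); let γ := fun z (s : ℝ) => (Φ N).flow s z; let bx : UnitAddTorus (Fin 3) → UnitAddTorus (Fin 3) → ℝ := fun x y => 3 / (Real.pi * r ^ 3) * max (1 - Literature.Analysis.FluidPDE.Torus.euclidDist x y / r) 0; let Θ := fun (Ξ : EuclideanSpace ℝ (Fin 3) × EuclideanSpace ℝ (Fin 3) × EuclideanSpace ℝ (Fin 3) → ℝ) (v w : EuclideanSpace ℝ (Fin 3)) => ∫ ω : Metric.sphere (0 : EuclideanSpace ℝ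 (Fin 3)) 1, Ξ ((ω : EuclideanSpace ℝ (Fin 3)), v, w) * Literature.MathematicalPhysics.KineticTheory.hardSphereKernel (w, v) ω ∂Literature.MathematicalPhysics.KineticTheory.sphereMeasure; let B := fun Ξ z s (x₀ : UnitAddTorus (Fin 3)) => ∫ p, bx p.1.1 x₀ * bx p.2.1 x₀ * Θ Ξ p.1.2 p.2.2 ∂((Literature.Analysis.FluidPDE.empiricalMeasure (γ z s)).prod (Literature.Analysis.FluidPDE.empiricalMeasure (γ z s))); let pv := fun z s (i j : Fin (N + 1)) => Literature.Analysis.FluidPDE.reflectVel (G.sepVec (γ z s i).1 (γ z s j).1) ((γ z s i).2, (γ z s j).2); let Kc := fun (Fn : Literature.Analysis.FluidPDE.Config (N + 1) (Fin 3) Literature.MathematicalPhysics.KineticTheory.T3 → ℝ → Fin (N + 1) → Fin (N + 1) → ℝ) z => ε / (N + 1 : ℝ) * ∑ᶠ (s : ℝ) (_ : s ∈ Literature.Analysis.FluidPDE.collisionTimes G ε (γ z) ∩ Set.Icc 0 τ), ∑ i : Fin (N + 1), ∑ j : Fin (N + 1), (if i ≠ j ∧ ‖G.sepVec (γ z s i).1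 (γ z s j).1‖ = ε then Fn z s i j else 0); μ {z | Kc (fun z s i j => χ (s, (γ z s i).1) * Ξ (ε⁻¹ • G.sepVec (γ z s i).1 (γ z s j).1, (pv z s i j).1, (pv z s i j).2)) z < g₀ * σ ^ 3 * (∫ s in Set.Icc (0 : ℝ) τ, ∫ x : UnitAddTorus (Fin 3), χ (s, x) * B Ξ z s x) - η} ≤ ENNReal.ofReal δ) → Summit.AtomisticToContinuum.HydrodynamicLimit.Theses.JParityClosure.RateFloor := by
  intro h
  obtain ⟨g₀, hg₀, σ₁, hσ₁, h⟩ := h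
  refine ⟨g₀, hg₀, fun a₀ θ₀ u₀ ha hθ hu ha0 hθ0 => ?_⟩
  refine ⟨min σ₁ 2⁻¹, lt_min hσ₁ (by norm_num), ?_⟩
  intro σ hσ hσlt Φ τ hτ χ hχc hχ0 Ξ hΞc hΞ0 hΞC η δ hη hδ
  have hσ₁' : σ < σ₁ := hσlt.trans_le (min_le_left _ _)
  have hσ2 : σ ≤ 1 / 2 := by
    have := hσlt.trans_le (min_le_right σ₁ 2⁻¹)
    rw [one_div]; exact this.le
  obtain ⟨A, b, hA, hb, hdom⟩ :=
    Summit.AtomisticToContinuum.HydrodynamicLimit.Theorems.LambertianContactSwapSwapGapGibbsDomination.exists_localGibbsLaw_dominated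
      ha hθ hu ha0 hθ0 hσ2
  obtain ⟨r₀, hr₀, h⟩ := h σ hσ hσ₁' Φ τ hτ χ hχc hχ0 Ξ hΞc hΞ0 hΞC A η δ hη hδ
  refine ⟨r₀, hr₀, fun r hr hrlt => ?_⟩
  obtain ⟨N₀, hN⟩ := h r hr hrlt
  refine ⟨N₀, fun N hNN => ?_⟩
  have hP : IsProbabilityMeasure (localGibbsLaw σ a₀ u₀ θ₀ N (Φ N)) :=
    isProbabilityMeasure_localGibbsLaw ha hθ hu ha0 hθ0 hσ2 N (Φ N)
  obtain ⟨-, -, hKL, -, -⟩ := hdom N (Φ N)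
  exact hN N hNN (localGibbsLaw σ a₀ u₀ θ₀ N (Φ N)) hP hKL

/-- **The entropy class from the super-exponential equilibrium deficit bound** (hypothesis = registered stub S11
`stub_eqSuperExpDeficit` of line `Sketch`, conclusion = the line's `EntropyClassRateFloor`, both written out): given the budget
`K` and `δ`, take `L := (log 2 + max K 0 + 1)/δ` and apply the entropy inequality for events through a measurable hull.
[cite: KipnisLandim1999, Appendix 1 Prop. 8.2] -/
theorem entropyClass_of_eqSuperExpDeficit :
    (∃ g₀ : ℝ, 0 < g₀ ∧ ∃ σ₀ : ℝ, 0 < σ₀ ∧ ∀ σ : ℝ, 0 < σ → σ < σ₀ → ∀ Φ : (N : ℕ) → Literature.Analysis.FluidPDE.HardSphereFlow (Literature.Analysis.FluidPDE.Torus.geometry (Fin 3)) (Literature.MathematicalPhysics.KineticTheory.hsDiameter σ N) (N + 1), ∀ τ : ℝ, 0 < τ → ∀ χ : ℝ × UnitAddTorus (Fin 3) → ℝ, Continuous χ → (∀ p, 0 ≤ χ p) → ∀ Ξ : EuclideanSpace ℝ (Fin 3) × EuclideanSpace ℝ (Fin 3) × EuclideanSpace ℝ (Fin 3) → ℝ,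 Continuous Ξ → (∀ q, 0 ≤ Ξ q) → (∃ C : ℝ, ∀ q, Ξ q ≤ C) → ∀ η : ℝ, 0 < η → ∀ L : ℝ, ∃ r₀ : ℝ, 0 < r₀ ∧ ∀ r : ℝ, 0 < r → r < r₀ → ∃ N₀ : ℕ, ∀ N : ℕ, N₀ ≤ N → let ε := Literature.MathematicalPhysics.KineticTheory.hsDiameter σ N; let G := Literature.Analysis.FluidPDE.Torus.geometry (Fin 3); let γ := fun z (s : ℝ) => (Φ N).flow s z; let bx : UnitAddTorus (Fin 3) → UnitAddTorus (Fin 3) → ℝ := fun x y => 3 / (Real.pi * r ^ 3) * max (1 - Literature.Analysis.FluidPDE.Torus.euclidDist x y / r) 0; let Θ := fun (Ξ : EuclideanSpace ℝ (Fin 3) × EuclideanSpace ℝ (Fin 3) × EuclideanSpace ℝ (Fin 3) → ℝ) (v w : EuclideanSpace ℝ (Fin 3)) => ∫ ω : Metric.sphere (0 : EuclideanSpace ℝ (Fin 3)) 1, Ξ ((ω : EuclideanSpace ℝ (Fin 3)), v, w) * Literature.MathematicalPhysics.KineticTheory.hardSphereKernel (w, v) ω ∂Literature.MathematicalPhysics.KineticTheory.sphereMeasure;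 let B := fun Ξ z s (x₀ : UnitAddTorus (Fin 3)) => ∫ p, bx p.1.1 x₀ * bx p.2.1 x₀ * Θ Ξ p.1.2 p.2.2 ∂((Literature.Analysis.FluidPDE.empiricalMeasure (γ z s)).prod (Literature.Analysis.FluidPDE.empiricalMeasure (γ z s))); let pv := fun z s (i j : Fin (N + 1)) => Literature.Analysis.FluidPDE.reflectVel (G.sepVec (γ z s i).1 (γ z s j).1) ((γ z s i).2, (γ z s j).2); let Kc := fun (Fn : Literature.Analysis.FluidPDE.Config (N + 1) (Fin 3) Literature.MathematicalPhysics.KineticTheory.T3 → ℝ → Fin (N + 1) → Fin (N + 1) → ℝ) z => ε / (N + 1 : ℝ) * ∑ᶠ (s : ℝ) (_ : s ∈ Literature.Analysis.FluidPDE.collisionTimes G ε (γ z) ∩ Set.Icc 0 τ), ∑ i : Fin (N + 1), ∑ j : Fin (N + 1), (if i ≠ j ∧ ‖G.sepVec (γ z s i).1 (γ z s j).1‖ = ε then Fn z s i j else 0); Literature.MathematicalPhysics.KineticTheory.localGibbsLaw σ (fun _ => (1 : ℝ)) (fun _ => (0 : EuclideanSpace ℝ (Fin 3))) (fun _ =>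 (1 : ℝ)) N (Φ N) {z | Kc (fun z s i j => χ (s, (γ z s i).1) * Ξ (ε⁻¹ • G.sepVec (γ z s i).1 (γ z s j).1, (pv z s i j).1, (pv z s i j).2)) z < g₀ * σ ^ 3 * (∫ s in Set.Icc (0 : ℝ) τ, ∫ x : UnitAddTorus (Fin 3), χ (s, x) * B Ξ z s x) - η} ≤ ENNReal.ofReal (Real.exp (-(L * ((N : ℝ) + 1))))) → (∃ g₀ : ℝ, 0 < g₀ ∧ ∃ σ₀ : ℝ, 0 < σ₀ ∧ ∀ σ : ℝ, 0 < σ → σ < σ₀ → ∀ Φ : (N : ℕ) → Literature.Analysis.FluidPDE.HardSphereFlow (Literature.Analysis.FluidPDE.Torus.geometry (Fin 3)) (Literature.MathematicalPhysics.KineticTheory.hsDiameter σ N) (N + 1), ∀ τ : ℝ, 0 < τ → ∀ χ : ℝ × UnitAddTorus (Fin 3) → ℝ, Continuous χ → (∀ p, 0 ≤ χ p) → ∀ Ξ : EuclideanSpace ℝ (Fin 3) × EuclideanSpace ℝ (Fin 3) × EuclideanSpace ℝ (Fin 3) → ℝ, Continuous Ξ → (∀ q, 0 ≤ Ξ q)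 → (∃ C : ℝ, ∀ q, Ξ q ≤ C) → ∀ K η δ : ℝ, 0 < η → 0 < δ → ∃ r₀ : ℝ, 0 < r₀ ∧ ∀ r : ℝ, 0 < r → r < r₀ → ∃ N₀ : ℕ, ∀ N : ℕ, N₀ ≤ N → ∀ μ : MeasureTheory.Measure (Literature.Analysis.FluidPDE.Config (N + 1) (Fin 3) Literature.MathematicalPhysics.KineticTheory.T3), MeasureTheory.IsProbabilityMeasure μ → InformationTheory.klDiv μ (Literature.MathematicalPhysics.KineticTheory.localGibbsLaw σ (fun _ => (1 : ℝ)) (fun _ => (0 : EuclideanSpace ℝ (Fin 3))) (fun _ => (1 : ℝ)) N (Φ N)) ≤ ENNReal.ofReal (K * ((N : ℝ) + 1)) → let ε := Literature.MathematicalPhysics.KineticTheory.hsDiameter σ N; let G := Literature.Analysis.FluidPDE.Torus.geometry (Fin 3); let γ := fun z (s : ℝ) => (Φ N).flow s z; let bx : UnitAddTorus (Fin 3) → UnitAddTorus (Fin 3) → ℝ := fun x y => 3 / (Real.pi * r ^ 3) * max (1 - Literature.Analysis.FluidPDE.Torus.euclidDist x y / r) 0; let Θ := fun (Ξ : EuclideanSpace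 ℝ (Fin 3) × EuclideanSpace ℝ (Fin 3) × EuclideanSpace ℝ (Fin 3) → ℝ) (v w : EuclideanSpace ℝ (Fin 3)) => ∫ ω : Metric.sphere (0 : EuclideanSpace ℝ (Fin 3)) 1, Ξ ((ω : EuclideanSpace ℝ (Fin 3)), v, w) * Literature.MathematicalPhysics.KineticTheory.hardSphereKernel (w, v) ω ∂Literature.MathematicalPhysics.KineticTheory.sphereMeasure; let B := fun Ξ z s (x₀ : UnitAddTorus (Fin 3)) => ∫ p, bx p.1.1 x₀ * bx p.2.1 x₀ * Θ Ξ p.1.2 p.2.2 ∂((Literature.Analysis.FluidPDE.empiricalMeasure (γ z s)).prod (Literature.Analysis.FluidPDE.empiricalMeasure (γ z s))); let pv := fun z s (i j : Fin (N + 1)) => Literature.Analysis.FluidPDE.reflectVel (G.sepVec (γ z s i).1 (γ z s j).1) ((γ z s i).2, (γ z s j).2); let Kc := fun (Fn : Literature.Analysis.FluidPDE.Config (N + 1) (Fin 3) Literature.MathematicalPhysics.KineticTheory.T3 → ℝ → Fin (N + 1) → Fin (N + 1) → ℝ) z => ε / (N + 1 : ℝ) * ∑ᶠ (s : ℝ)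 (_ : s ∈ Literature.Analysis.FluidPDE.collisionTimes G ε (γ z) ∩ Set.Icc 0 τ), ∑ i : Fin (N + 1), ∑ j : Fin (N + 1), (if i ≠ j ∧ ‖G.sepVec (γ z s i).1 (γ z s j).1‖ = ε then Fn z s i j else 0); μ {z | Kc (fun z s i j => χ (s, (γ z s i).1) * Ξ (ε⁻¹ • G.sepVec (γ z s i).1 (γ z s j).1, (pv z s i j).1, (pv z s i j).2)) z < g₀ * σ ^ 3 * (∫ s in Set.Icc (0 : ℝ) τ, ∫ x : UnitAddTorus (Fin 3), χ (s, x) * B Ξ z s x) - η} ≤ ENNReal.ofReal δ) := by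
  intro h
  obtain ⟨g₀, hg₀, σ₀, hσ₀, h⟩ := h
  refine ⟨g₀, hg₀, min σ₀ 2⁻¹, lt_min hσ₀ (by norm_num), ?_⟩
  intro σ hσ hσlt' Φ τ hτ χ hχc hχ0 Ξ hΞc hΞ0 hΞC K η δ hη hδ
  have hσlt : σ < σ₀ := hσlt'.trans_le (min_le_left _ _)
  have hσ2 : σ ≤ 1 / 2 := by
    have := hσlt'.trans_le (min_le_right σ₀ 2⁻¹)
    rw [one_div]; exact this.le
  set K' : ℝ := max K 0 with hK'
  have hK'0 : 0 ≤ K' := le_max_right _ _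
  set L : ℝ := (Real.log 2 + K' + 1) / δ with hL
  have hlog : 0 < Real.log 2 := Real.log_pos (by norm_num)
  have hLpos : 0 < L := by positivity
  obtain ⟨r₀, hr₀, h⟩ := h σ hσ hσlt Φ τ hτ χ hχc hχ0 Ξ hΞc hΞ0 hΞC η hη L
  refine ⟨r₀, hr₀, fun r hr hrlt => ?_⟩
  obtain ⟨N₀, hN⟩ := h r hr hrlt
  refine ⟨N₀, fun N hNN μ hμ hKL => ?_⟩
  have h1 := hN N hNN
  intro ε G γ bx Θ B pv Kc
  haveI : IsProbabilityMeasure μ := hμ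
  haveI : IsProbabilityMeasure (localGibbsLaw σ (fun _ => (1 : ℝ)) (fun _ => (0 : EuclideanSpace ℝ (Fin 3)))
      (fun _ => (1 : ℝ)) N (Φ N)) :=
    isProbabilityMeasure_localGibbsLaw (a₀ := fun _ => (1 : ℝ)) (θ₀ := fun _ => (1 : ℝ))
      (u₀ := fun _ => (0 : EuclideanSpace ℝ (Fin 3))) continuous_const continuous_const continuous_const
      (fun _ => one_pos) (fun _ => one_pos) hσ2 N (Φ N)
  have hn1 : (1 : ℝ) ≤ (N : ℝ) + 1 := by
    have : (0 : ℝ) ≤ (N : ℝ) := Nat.cast_nonneg N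
    linarith
  have hGpos : 0 < L * ((N : ℝ) + 1) := by positivity
  have hKL' : klDiv μ (localGibbsLaw σ (fun _ => (1 : ℝ)) (fun _ => (0 : EuclideanSpace ℝ (Fin 3)))
      (fun _ => (1 : ℝ)) N (Φ N)) ≤ ENNReal.ofReal (K' * ((N : ℝ) + 1)) :=
    hKL.trans (ENNReal.ofReal_le_ofReal (mul_le_mul_of_nonneg_right (le_max_left _ _) (by positivity)))
  have e1 : localGibbsLaw σ (fun _ => (1 : ℝ)) (fun _ => (0 : EuclideanSpace ℝ (Fin 3))) (fun _ => (1 : ℝ)) N (Φ N)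
      {z | Kc (fun z s i j => χ (s, (γ z s i).1) *
        Ξ (ε⁻¹ • G.sepVec (γ z s i).1 (γ z s j).1, (pv z s i j).1, (pv z s i j).2)) z <
        g₀ * σ ^ 3 * (∫ s in Set.Icc (0 : ℝ) τ, ∫ x : UnitAddTorus (Fin 3), χ (s, x) * B Ξ z s x) - η} ≤
      ENNReal.ofReal (Real.exp (-(L * ((N : ℝ) + 1)))) := h1
  have h2 := measure_le_of_klDiv_le_hull μ _ _ hGpos (by positivity : (0 : ℝ) ≤ K' * ((N : ℝ) + 1)) e1 hKL'
  refine h2.trans (ENNReal.ofReal_le_ofReal ?_)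
  rw [hL]
  exact entropy_transfer_arith hK'0 hδ hn1

/-! ## The composition -/

/-- **`RateFloor` FROM THE SUPER-EXPONENTIAL EQUILIBRIUM DEFICIT BOUND** (registered stub
`stub_rateFloor_of_eqSuperExpDeficit` of line `Sketch`; def-free tree copy of the skeleton's first composition
`rateFloor_of_eqSuperExpDeficit`, hypothesis = registered stub S11 `stub_eqSuperExpDeficit` written out): the crux for every
continuous local Gibbs datum follows from the bound `G_N(E_N) ≤ exp(−L(N+1))` (`r < r₀(L)`, `N ≥ N₀`) for its event under
the invariant standard homogeneous Gibbs law.  `stub_rateFloor_of_entropyClass ∘ entropyClass_of_eqSuperExpDeficit`.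
[cite: KipnisLandim1999, Appendix 1 Prop. 8.2] -/
theorem stub_rateFloor_of_eqSuperExpDeficit :
    (∃ g₀ : ℝ, 0 < g₀ ∧ ∃ σ₀ : ℝ, 0 < σ₀ ∧ ∀ σ : ℝ, 0 < σ → σ < σ₀ → ∀ Φ : (N : ℕ) → Literature.Analysis.FluidPDE.HardSphereFlow (Literature.Analysis.FluidPDE.Torus.geometry (Fin 3)) (Literature.MathematicalPhysics.KineticTheory.hsDiameter σ N) (N + 1), ∀ τ : ℝ, 0 < τ → ∀ χ : ℝ × UnitAddTorus (Fin 3) → ℝ, Continuous χ → (∀ p, 0 ≤ χ p) → ∀ Ξ : EuclideanSpace ℝ (Fin 3) × EuclideanSpace ℝ (Fin 3) × EuclideanSpace ℝ (Fin 3) → ℝ, Continuous Ξ → (∀ q, 0 ≤ Ξ q) → (∃ C : ℝ, ∀ q, Ξ q ≤ C) → ∀ η : ℝ, 0 < η → ∀ L : ℝ, ∃ r₀ : ℝ, 0 < r₀ ∧ ∀ r : ℝ, 0 < r → r < r₀ → ∃ N₀ : ℕ, ∀ N : ℕ, N₀ ≤ N → let ε := Literature.MathematicalPhysics.KineticTheory.hsDiameter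 σ N; let G := Literature.Analysis.FluidPDE.Torus.geometry (Fin 3); let γ := fun z (s : ℝ) => (Φ N).flow s z; let bx : UnitAddTorus (Fin 3) → UnitAddTorus (Fin 3) → ℝ := fun x y => 3 / (Real.pi * r ^ 3) * max (1 - Literature.Analysis.FluidPDE.Torus.euclidDist x y / r) 0; let Θ := fun (Ξ : EuclideanSpace ℝ (Fin 3) × EuclideanSpace ℝ (Fin 3) × EuclideanSpace ℝ (Fin 3) → ℝ) (v w : EuclideanSpace ℝ (Fin 3)) => ∫ ω : Metric.sphere (0 : EuclideanSpace ℝ (Fin 3)) 1, Ξ ((ω : EuclideanSpace ℝ (Fin 3)), v, w) * Literature.MathematicalPhysics.KineticTheory.hardSphereKernel (w, v) ω ∂Literature.MathematicalPhysics.KineticTheory.sphereMeasure; let B := fun Ξ z s (x₀ : UnitAddTorus (Fin 3)) => ∫ p, bx p.1.1 x₀ * bx p.2.1 x₀ * Θ Ξ p.1.2 p.2.2 ∂((Literature.Analysis.FluidPDE.empiricalMeasure (γ z s)).prod (Literature.Analysis.FluidPDE.empiricalMeasure (γ z s))); let pv := fun z s (i j : Fin (N + 1)) => Literature.Analysis.FluidPDE.reflectVel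 (G.sepVec (γ z s i).1 (γ z s j).1) ((γ z s i).2, (γ z s j).2); let Kc := fun (Fn : Literature.Analysis.FluidPDE.Config (N + 1) (Fin 3) Literature.MathematicalPhysics.KineticTheory.T3 → ℝ → Fin (N + 1) → Fin (N + 1) → ℝ) z => ε / (N + 1 : ℝ) * ∑ᶠ (s : ℝ) (_ : s ∈ Literature.Analysis.FluidPDE.collisionTimes G ε (γ z) ∩ Set.Icc 0 τ), ∑ i : Fin (N + 1), ∑ j : Fin (N + 1), (if i ≠ j ∧ ‖G.sepVec (γ z s i).1 (γ z s j).1‖ = ε then Fn z s i j else 0); Literature.MathematicalPhysics.KineticTheory.localGibbsLaw σ (fun _ => (1 : ℝ)) (fun _ => (0 : EuclideanSpace ℝ (Fin 3))) (fun _ => (1 : ℝ)) N (Φ N) {z | Kc (fun z s i j => χ (s, (γ z s i).1) * Ξ (ε⁻¹ • G.sepVec (γ z s i).1 (γ z s j).1, (pv z s i j).1, (pv z s i j).2)) z < g₀ * σ ^ 3 * (∫ s in Set.Icc (0 : ℝ) τ, ∫ x : UnitAddTorus (Fin 3), χ (s, x) * B Ξ z s x) - η} ≤ ENNReal.ofReal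 (Real.exp (-(L * ((N : ℝ) + 1))))) → Summit.AtomisticToContinuum.HydrodynamicLimit.Theses.JParityClosure.RateFloor :=
  fun h => stub_rateFloor_of_entropyClass (entropyClass_of_eqSuperExpDeficit h)

end Summit.AtomisticToContinuum.HydrodynamicLimit.Theorems.RateFloorEntropyTransfer

end
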